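import Summits.AnomalousDissipation.AnomalousDissipation.Theorems.SolenoidalFractalHomogenisationRealisedQuasiStaticCellLawUpperSomePeriod
import HarnessLib

/-!
# K2R `RealisedQuasiStaticCellLaw`, line `floquet-bloch`, stub `stub_upperSome`: the principal pair over all times
# (Galerkin level) — periods chained, interior bound

Summits-side helper (everything proved; no definitions, no named facts; `--supports stmt-AnomalousDissipation-20446`).
`upperSome_galerkin_lower`: `upperSome_period` iterated over the periods (the cone is inherited), then the interior bound:
`x(0)·e^{−(L/P)t}/2^{k₀+1} ≤ x(t)` for all `t ≥ 0`, `L` the period rate of `upperSome_period`. Energy LOWER-bound half of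
the K2R bracket; not anomalous dissipation.
-/

set_option linter.dupNamespace false -- layout D-0017: `AnomalousDissipation.AnomalousDissipation` repeats by design

noncomputable section

namespace Summit.AnomalousDissipation.AnomalousDissipation.Theorems.SolenoidalFractalHomogenisation.RealisedQuasiStaticCellLaw

open Set MeasureTheory Filter Topology Function Complex Matrix
open scoped InnerProductSpace ComplexConjugate Matrix BigOperators
open Literature.Analysis Literature.Analysis.FunctionSpaces Literature.Analysis.FunctionSpaces.Torus
open Literature.Analysis.FluidPDE Literature.Analysis.FluidPDE.LatticeShear
open Summit.AnomalousDissipation.AnomalousDissipation.Theorems.SolenoidalFractalHomogenisation.PermissibleCarrier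

variable {k₀ : ℕ}

set_option maxHeartbeats 800000 in -- one period theorem per induction step
/-- **The principal pair over all times (Galerkin level).** Under the hypotheses of `upperSome_period`, the initial cone
`R(0) ≤ ηx(0)`, `x(0) > 0` and nonnegativity of the period rate `L`: for every `t ≥ 0`,
`x(0)·exp(−(L/P)t)/2^{k₀+1} ≤ x(t) = ‖α_N(t)(ℓ)‖²` (induction over the periods, then the interior bound). -/
theorem upperSome_galerkin_lower (W : LatticeWord k₀) {n : ℕ} (hn : 0 < n) {κ : ℝ} (hκ : 0 < κ)
    (ℓ : Fin 3 → ℤ) (hℓn : 2 * ‖latticeVec ℓ‖ ≤ n) {w₀ : UnitAddTorus (Fin 3) → EuclideanSpace ℝ (Fin 3)}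
    (hw₀ : FunctionSpaces.Torus.MemSobolev 1 (FunctionSpaces.EuclideanSpace.complexify ∘ w₀))
    (hdiv : FunctionSpaces.Torus.IsWeaklyDivFree w₀) (hmean : FunctionSpaces.Torus.HasZeroMean w₀)
    (hsupp : ∀ k : Fin 3 → ℤ, ¬ ((∃ z : Fin 3 → ℤ, k = ℓ + (n:ℤ) • z) ∨ (∃ z : Fin 3 → ℤ, k = -ℓ + (n:ℤ) • z)) →
      UnitAddTorus.mFourierCoeff (FunctionSpaces.EuclideanSpace.complexify ∘ w₀) k = 0)
    {N : ℕ} (hBN : (Finset.univ.biUnion fun j : Fin k₀ =>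
        ({(fun i => (W.phase j).m i * n), -(fun i => (W.phase j).m i * n)} : Finset (Fin 3 → ℤ))) ⊆ freqBall N)
    (hk : ∀ j : Fin k₀, ∀ J : ℤ, ℓ + J • (fun i => (W.phase j).m i * (n : ℤ)) ∈ freqBall N →
      ℓ + J • (fun i => (W.phase j).m i * (n : ℤ)) ≠ 0)
    (hdisj : ∀ j : Fin k₀, ∀ J J' : ℤ,
      ℓ + J • (fun i => (W.phase j).m i * (n : ℤ)) ≠ -(ℓ + J' • (fun i => (W.phase j).m i * (n : ℤ))))
    (ζr : Fin k₀ → Fin 3 → ℝ) (hζ1 : ∀ j, ζr j ⬝ᵥ ζr j = 1) (hζ0 : ∀ j, ζr j ⬝ᵥ (fun i => ((ℓ i : ℤ) : ℝ)) = 0)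
    (hζK : ∀ j, ζr j ⬝ᵥ (fun i => (((fun i => (W.phase j).m i * (n : ℤ)) i : ℤ) : ℝ)) = 0)
    (pf : Fin k₀ → ℤ → Fin 3 → ℝ)
    (hp : ∀ j, ∀ J : ℤ, pf j J = (Real.sqrt ((fun i => (((ℓ + J • (fun i => (W.phase j).m i * (n : ℤ))) i : ℤ) : ℝ)) ⬝ᵥ
        (fun i => (((ℓ + J • (fun i => (W.phase j).m i * (n : ℤ))) i : ℤ) : ℝ))))⁻¹ •
        (fun i => (((ℓ + J • (fun i => (W.phase j).m i * (n : ℤ))) i : ℤ) : ℝ)) ⨯₃ ζr j)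
    (Wset : Fin k₀ → Finset ℤ)
    (hW : ∀ j, ∀ J : ℤ, J ∈ Wset j ↔ ℓ + J • (fun i => (W.phase j).m i * (n : ℤ)) ∈ freqBall N)
    (h0 : ∀ j, (0 : ℤ) ∈ Wset j) (h1 : ∀ j, (1 : ℤ) ∈ Wset j) (hm1 : ∀ j, (-1 : ℤ) ∈ Wset j)
    (hs : ∀ j, ∀ J ∈ Wset j, |pf j J ⬝ᵥ pf j (J + 1)| ≤ 1)
    (Λ σo σi g₁ γ : Fin k₀ → ℝ) (Δ ε β : ℝ)
    (hΛ : ∀ j, Λ j = κ * (4 * Real.pi ^ 2 * freqNormSq (fun i => (W.phase j).m i * (n : ℤ))))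
    (hΔ0 : 0 < Δ) (hε : 0 ≤ ε) (hβ : 0 ≤ β)
    (hgap : ∀ j, ∀ J ∈ Wset j, J ≠ 0 →
      freqNormSq ℓ / freqNormSq (fun i => (W.phase j).m i * (n : ℤ)) + Δ ≤
        freqNormSq (ℓ + J • (fun i => (W.phase j).m i * (n : ℤ))) / freqNormSq (fun i => (W.phase j).m i * (n : ℤ)))
    (hσo : ∀ j, σo j = 1 / (freqNormSq (ℓ + (-1 : ℤ) • (fun i => (W.phase j).m i * (n : ℤ))) /
          freqNormSq (fun i => (W.phase j).m i * (n : ℤ)) - freqNormSq ℓ / freqNormSq (fun i => (W.phase j).m i * (n : ℤ))) +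
        1 / (freqNormSq (ℓ + (1 : ℤ) • (fun i => (W.phase j).m i * (n : ℤ))) /
          freqNormSq (fun i => (W.phase j).m i * (n : ℤ)) - freqNormSq ℓ / freqNormSq (fun i => (W.phase j).m i * (n : ℤ))))
    (hσi : ∀ j, σi j = (pf j (-1) ⬝ᵥ pf j 0) ^ 2 / (freqNormSq (ℓ + (-1 : ℤ) • (fun i => (W.phase j).m i * (n : ℤ))) /
          freqNormSq (fun i => (W.phase j).m i * (n : ℤ)) - freqNormSq ℓ / freqNormSq (fun i => (W.phase j).m i * (n : ℤ))) +
        (pf j 0 ⬝ᵥ pf j 1) ^ 2 / (freqNormSq (ℓ + (1 : ℤ) • (fun i => (W.phase j).m i * (n : ℤ))) /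
          freqNormSq (fun i => (W.phase j).m i * (n : ℤ)) - freqNormSq ℓ / freqNormSq (fun i => (W.phase j).m i * (n : ℤ))))
    (hγ : ∀ j, γ j ^ 2 = (pf j 0 ⬝ᵥ pf j 1) ^ 2 + (pf j (-1) ⬝ᵥ pf j 0) ^ 2) (hγ0 : ∀ j, 0 ≤ γ j)
    (hg₁ : ∀ j, g₁ j = 2 * Real.pi * (∑ i, (W.phase j).e i * (ℓ i : ℝ)) *
        ‖Complex.exp ((W.phase j).φ * Complex.I) *
          (1 / (2 * ((2 * Real.pi * ‖latticeVec (W.phase j).m‖ : ℝ) : ℂ) * Complex.I))‖ * (1 / (n : ℝ)) / Λ j)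
    (hβo : ∀ j, 2 ≤ β * Δ * ε * σo j) (hβi : ∀ j, γ j ^ 2 ≤ β * Δ * ε * σi j)
    (hsmallo : ∀ j, g₁ j ^ 2 * (4 * 2 / Δ + 2 * (1 + ε) * σo j) +
      2 * (4 * β * 2 * (Λ j * |g₁ j| ^ 3 * σo j + |g₁ j| / (W.ramp * (W.phase j).τ) + Λ j * |g₁ j| ^ 2) ^ 2 /
        (Λ j * Δ ^ 3)) / Λ j ≤ Δ)
    (hsmalli : ∀ j, g₁ j ^ 2 * (4 * γ j ^ 2 / Δ + 2 * (1 + ε) * σi j) +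
      2 * (4 * β * γ j ^ 2 * (Λ j * |g₁ j| ^ 3 * σi j + |g₁ j| / (W.ramp * (W.phase j).τ) + Λ j * |g₁ j| ^ 2) ^ 2 /
        (Λ j * Δ ^ 3)) / Λ j ≤ Δ)
    (hθo34 : ∀ j, 3 / 4 ≤ Real.exp (-(2 * Λ j * (W.phase j).τ * (freqNormSq ℓ / freqNormSq (fun i => (W.phase j).m i * (n : ℤ)) +
              (1 + ε) * σo j * (g₁ j ^ 2 * (1 - 4 * W.ramp / 3))) +
            40 * β * 2 * Λ j * (W.phase j).τ * g₁ j ^ 4 * (1 + g₁ j ^ 2 * σo j ^ 2) / Δ ^ 3 +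
            48 * β * 2 * g₁ j ^ 2 / (W.ramp * (W.phase j).τ * Λ j * Δ ^ 3))))
    (hθi34 : ∀ j, 3 / 4 ≤ Real.exp (-(2 * Λ j * (W.phase j).τ * (freqNormSq ℓ / freqNormSq (fun i => (W.phase j).m i * (n : ℤ)) +
              (1 + ε) * σi j * (g₁ j ^ 2 * (1 - 4 * W.ramp / 3))) +
            40 * β * γ j ^ 2 * Λ j * (W.phase j).τ * g₁ j ^ 4 * (1 + g₁ j ^ 2 * σi j ^ 2) / Δ ^ 3 +
            48 * β * γ j ^ 2 * g₁ j ^ 2 / (W.ramp * (W.phase j).τ * Λ j * Δ ^ 3))))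
    (hθf : ∀ j, max (Real.exp (-(Λ j * Δ) * (W.phase j).τ))
      (Real.exp (-(8 * Real.pi ^ 2 * κ * ((n : ℝ) / 2) ^ 2) * (W.phase j).τ)) ≤ 1 / 4)
    (η : ℝ) (hc : ∀ j, 12 * (2 * g₁ j ^ 2 * (2 + γ j ^ 2) / Δ ^ 2) ≤ η) (hη1 : η ≤ 1) (hβη : β * η ≤ 1 / 2)
    (rr X : ℝ) (hrr : 0 ≤ rr)
    (hσoU : ∀ j, σo j ≤ 2 + 2 * rr)
    (hσiU : ∀ j, σi j ≤ 2 * (((fun i => ((ℓ i : ℤ) : ℝ)) ⬝ᵥ (fun i => (((fun i => (W.phase j).m i * (n : ℤ)) i : ℤ) : ℝ))) ^ 2 /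
      (freqNormSq ℓ * freqNormSq (fun i => (W.phase j).m i * (n : ℤ)))) + 26 * rr)
    (hiso : ∀ b : EuclideanSpace ℂ (Fin 3), ∑ i, ((ℓ i : ℤ) : ℂ) * b i = 0 →
      ∑ j, 2 * (2 * Λ j * (W.phase j).τ * g₁ j ^ 2) * (‖inner ℂ (WithLp.toLp 2 (Complex.ofReal ∘ ζr j) : EuclideanSpace ℂ (Fin 3)) b‖ ^ 2 +
        ((fun i => ((ℓ i : ℤ) : ℝ)) ⬝ᵥ (fun i => (((fun i => (W.phase j).m i * (n : ℤ)) i : ℤ) : ℝ))) ^ 2 / (freqNormSq ℓ * freqNormSq (fun i => (W.phase j).m i * (n : ℤ))) *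
          ‖inner ℂ (WithLp.toLp 2 (Complex.ofReal ∘ pf j 0) : EuclideanSpace ℂ (Fin 3)) b‖ ^ 2) = X * ‖b‖ ^ 2)
    (hcone0 : ∑ k ∈ freqBall N, ‖(pvSetup_cell W hn hκ.le ℓ hw₀ hdiv hmean hsupp).galerkinCoeffAt N 0 k‖ ^ 2 - 2 * ‖(pvSetup_cell W hn hκ.le ℓ hw₀ hdiv hmean hsupp).galerkinCoeffAt N 0 ℓ‖ ^ 2 ≤ η * ‖(pvSetup_cell W hn hκ.le ℓ hw₀ hdiv hmean hsupp).galerkinCoeffAt N 0 ℓ‖ ^ 2)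
    (hx0 : 0 < ‖(pvSetup_cell W hn hκ.le ℓ hw₀ hdiv hmean hsupp).galerkinCoeffAt N 0 ℓ‖ ^ 2)
    (hL : 0 ≤ ((∑ j, (2 * Λ j * (W.phase j).τ * (freqNormSq ℓ / freqNormSq (fun i => (W.phase j).m i * (n : ℤ))) + ((40 * β * 2 * Λ j * (W.phase j).τ * g₁ j ^ 4 * (1 + g₁ j ^ 2 * σo j ^ 2) / Δ ^ 3 + 48 * β * 2 * g₁ j ^ 2 / (W.ramp * (W.phase j).τ * Λ j * Δ ^ 3)) + (40 * β * γ j ^ 2 * Λ j * (W.phase j).τ * g₁ j ^ 4 * (1 + g₁ j ^ 2 * σi j ^ 2) / Δ ^ 3 + 48 * β * γ j ^ 2 * g₁ j ^ 2 / (W.ramp * (W.phase j).τ * Λ j * Δ ^ 3))) + β * η)) +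
          (1 + ε) * (1 - 4 * W.ramp / 3) * (X +
            (16 * (Real.exp (κ * (4 * Real.pi ^ 2 * freqNormSq ℓ) * W.period) * (∑ j, Real.exp (κ * (4 * Real.pi ^ 2 * freqNormSq ℓ) * (W.phase j).τ) * (Λ j * |g₁ j| * (Real.sqrt 2 + γ j)) * (W.phase j).τ) * Real.sqrt (3 * η)) +
              26 * rr) * ∑ j, 2 * Λ j * (W.phase j).τ * g₁ j ^ 2))) :
    ∀ t : ℝ, 0 ≤ t →
      ‖(pvSetup_cell W hn hκ.le ℓ hw₀ hdiv hmean hsupp).galerkinCoeffAt N 0 ℓ‖ ^ 2 * Real.exp (-(((∑ j, (2 * Λ j * (W.phase j).τ * (freqNormSq ℓ / freqNormSq (fun i => (W.phase j).m i * (n : ℤ))) + ((40 * β * 2 * Λ j * (W.phase j).τ * g₁ j ^ 4 * (1 + g₁ j ^ 2 * σo j ^ 2) / Δ ^ 3 + 48 * β * 2 * g₁ j ^ 2 / (W.ramp * (W.phase j).τ * Λ j * Δ ^ 3)) + (40 * β * γ j ^ 2 * Λ j * (W.phase j).τ * g₁ j ^ 4 * (1 + g₁ j ^ 2 * σi j ^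 2) / Δ ^ 3 + 48 * β * γ j ^ 2 * g₁ j ^ 2 / (W.ramp * (W.phase j).τ * Λ j * Δ ^ 3))) + β * η)) +
          (1 + ε) * (1 - 4 * W.ramp / 3) * (X +
            (16 * (Real.exp (κ * (4 * Real.pi ^ 2 * freqNormSq ℓ) * W.period) * (∑ j, Real.exp (κ * (4 * Real.pi ^ 2 * freqNormSq ℓ) * (W.phase j).τ) * (Λ j * |g₁ j| * (Real.sqrt 2 + γ j)) * (W.phase j).τ) * Real.sqrt (3 * η)) +
              26 * rr) * ∑ j, 2 * Λ j * (W.phase j).τ * g₁ j ^ 2)) / W.period) * t) / 2 ^ (k₀ + 1) ≤ ‖(pvSetup_cell W hn hκ.le ℓ hw₀ hdiv hmean hsupp).galerkinCoeffAt N t ℓ‖ ^ 2 := by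
  classical
  set hPV := pvSetup_cell W hn hκ.le ℓ hw₀ hdiv hmean hsupp with hPVdef
  have hP : 0 < W.period := period_pos W
  obtain ⟨L, hLdef⟩ : ∃ L : ℝ, L = ((∑ j, (2 * Λ j * (W.phase j).τ * (freqNormSq ℓ / freqNormSq (fun i => (W.phase j).m i * (n : ℤ))) + ((40 * β * 2 * Λ j * (W.phase j).τ * g₁ j ^ 4 * (1 + g₁ j ^ 2 * σo j ^ 2) / Δ ^ 3 + 48 * β * 2 * g₁ j ^ 2 / (W.ramp * (W.phase j).τ * Λ j * Δ ^ 3)) + (40 * β * γ j ^ 2 * Λ j * (W.phase j).τ * g₁ j ^ 4 * (1 + g₁ j ^ 2 * σi j ^ 2) / Δ ^ 3 + 48 * β * γ j ^ 2 * g₁ j ^ 2 / (W.ramp * (W.phase j).τ * Λ j * Δ ^ 3))) + β * η)) +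
          (1 + ε) * (1 - 4 * W.ramp / 3) * (X +
            (16 * (Real.exp (κ * (4 * Real.pi ^ 2 * freqNormSq ℓ) * W.period) * (∑ j, Real.exp (κ * (4 * Real.pi ^ 2 * freqNormSq ℓ) * (W.phase j).τ) * (Λ j * |g₁ j| * (Real.sqrt 2 + γ j)) * (W.phase j).τ) * Real.sqrt (3 * η)) +
              26 * rr) * ∑ j, 2 * Λ j * (W.phase j).τ * g₁ j ^ 2)) := ⟨_, rfl⟩
  rw [← hLdef] at hL ⊢
  have hper := fun q => upperSome_period W hn hκ ℓ hℓn hw₀ hdiv hmean hsupp hBN hk hdisj ζr hζ1 hζ0 hζK pf hp Wset hW h0 h1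
    hm1 hs Λ σo σi g₁ γ Δ ε β hΛ hΔ0 hε hβ hgap hσo hσi hγ hγ0 hg₁ hβo hβi hsmallo hsmalli hθo34 hθi34 hθf η hc hη1 hβη rr
    X hrr hσoU hσiU hiso q
  -- induction over the periods
  have hind : ∀ q : ℕ,
      (∑ k ∈ freqBall N, ‖hPV.galerkinCoeffAt N ((q : ℝ) * W.period) k‖ ^ 2 -
          2 * ‖hPV.galerkinCoeffAt N ((q : ℝ) * W.period) ℓ‖ ^ 2 ≤ η * ‖hPV.galerkinCoeffAt N ((q : ℝ) * W.period) ℓ‖ ^ 2 ∧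
        0 < ‖hPV.galerkinCoeffAt N ((q : ℝ) * W.period) ℓ‖ ^ 2) ∧
      Real.log (‖hPV.galerkinCoeffAt N 0 ℓ‖ ^ 2) - (q : ℝ) * L ≤ Real.log (‖hPV.galerkinCoeffAt N ((q : ℝ) * W.period) ℓ‖ ^ 2) := by
    intro q
    induction q with
    | zero =>
      simp only [Nat.cast_zero, zero_mul, sub_zero]
      exact ⟨⟨hcone0, hx0⟩, le_rfl⟩
    | succ q ih =>
      obtain ⟨⟨hcq, hxq⟩, hlq⟩ := ih
      obtain ⟨hinv, hlog, -⟩ := hper q hcq hxq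
      rw [← hLdef] at hlog
      push_cast
      refine ⟨hinv, ?_⟩
      linarith
  intro t ht
  -- locate `t` in its period
  set q : ℕ := ⌊t / W.period⌋₊ with hq
  have hq1 : (q : ℝ) * W.period ≤ t := by
    have := Nat.floor_le (div_nonneg ht hP.le); rw [← hq] at this
    exact (le_div_iff₀ hP).1 this
  have hq2 : t ≤ ((q : ℝ) + 1) * W.period := by
    have := Nat.lt_floor_add_one (t / W.period); rw [← hq] at this
    exact ((div_lt_iff₀ hP).1 this).le
  obtain ⟨⟨hcq, hxq⟩, hlq⟩ := hind q
  obtain ⟨-, -, hint⟩ := hper q hcq hxq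
  have h1 := hint t ⟨hq1, hq2⟩
  -- `x(qP) ≥ x(0) e^{−qL} ≥ x(0) e^{−(L/P) t}`
  have hqt : (q : ℝ) ≤ t / W.period := by rw [le_div_iff₀ hP]; exact hq1
  have h2 : ‖hPV.galerkinCoeffAt N 0 ℓ‖ ^ 2 * Real.exp (-(L / W.period) * t) ≤
      ‖hPV.galerkinCoeffAt N ((q : ℝ) * W.period) ℓ‖ ^ 2 := by
    have e : ‖hPV.galerkinCoeffAt N 0 ℓ‖ ^ 2 * Real.exp (-(L / W.period) * t) =
        Real.exp (Real.log (‖hPV.galerkinCoeffAt N 0 ℓ‖ ^ 2) - (L / W.period) * t) := by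
      rw [Real.exp_sub, Real.exp_log hx0, show -(L / W.period) * t = -(L / W.period * t) by ring, Real.exp_neg]
      exact (div_eq_mul_inv _ _).symm
    rw [e, ← Real.exp_log hxq]
    refine Real.exp_le_exp.2 (le_trans ?_ hlq)
    have : (q : ℝ) * L ≤ L / W.period * t := by
      have := mul_le_mul_of_nonneg_right hqt hL
      calc (q : ℝ) * L ≤ t / W.period * L := this
        _ = L / W.period * t := by ring
    linarith
  calc ‖hPV.galerkinCoeffAt N 0 ℓ‖ ^ 2 * Real.exp (-(L / W.period) * t) / 2 ^ (k₀ + 1)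
      ≤ ‖hPV.galerkinCoeffAt N ((q : ℝ) * W.period) ℓ‖ ^ 2 / 2 ^ (k₀ + 1) :=
        div_le_div_of_nonneg_right h2 (by positivity)
    _ ≤ ‖hPV.galerkinCoeffAt N t ℓ‖ ^ 2 := h1

end Summit.AnomalousDissipation.AnomalousDissipation.Theorems.SolenoidalFractalHomogenisation.RealisedQuasiStaticCellLaw

end
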